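import Literature.MathematicalPhysics.QuantumFieldTheory.Balaban1983to89.B9Eq346MixedLegAtPinsL2

/-!
# `Balaban1983to89.B9Eq346SecondLegAtPinsL2` — T. Bałaban, *Propagators for lattice gauge theories in a background field*, Commun. Math. Phys. **99**
# (1985) 389–434 [Balaban1985BackgroundPropagators] Cor 3.6 p. 408 ∕ (3.46) p. 398 (the second-order line `‖hG′(U)∇\*_U∇\*_Uλ‖`) ∕ (3.87)–(3.90) pp. 408–410:
# ★★ **THE SECOND-ORDER `L²` LEG OF THE THEOREM-3.7 WALK — dag-n06-k's `L2SecondLegs37.l5` FIELD `BlockBd blk blk ((M_{h_c} G′_c M_{h_c}) ∘ (Dsd ν ∘ Dsd μ)) (1_{S_c}·B₃·e^{−δd})`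
# — READ AT THE N06 CERTIFICATE's COORDINATE MODELS: the unconditional dictionary and the torus-to-pins transfer, with the lattice `H²` estimate of `G′_□` left as the
# ONE explicit hypothesis** (its engine — discrete Bochner–Weitzenböck + curvature commutators on the (3.35) class — is dag-n06-w1's open piece (A2))

statement-level skeleton of published theorems with citation tags; proofs where landed; nothing here is a claim about the Yang–Mills mass gap

THE PRINT.  p. 398 (3.46), third line: *«‖hG′(U)∇\*_U∇\*_Uλ‖ ≤ B₀e^{−δ₀d(y,y′)}‖h‖‖λ‖»* (order zero: `G′` smooths two covariant derivatives); p. 408 Cor 3.6 (*«constants independent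
of □»*); p. 409 (3.87)–(3.90); [4] (2.51)–(2.54) pp. 232–233, (2.45)–(2.46) p. 231, Lemma 2.1 (2.61) p. 234, p. 235.

WHY THIS FILE (cell context; second half of the located hand «coordinate reading of the rows-18 `L²` legs», width seat `pub-ymgap-dag-n06-w7` on the knit owner dag-n06-d's
word, pub-ymgap bus 2026-08-28).  Rows 18's `h36H` displays `L2SecondLegs37 (𝔬 x) (𝔡 x) 1 (H x) (S3 x) p3.B3 p.δ₀ U` (dag-n06-k `B9RWSums346SecondDiffGp`).  Unlike the mixed
leg (prequel `B9Eq346MixedLegAtPinsL2`, PROVED), its analytic input — an `L²` block-decay bound of `M_{h_□}G′_□M_{h_□}∇\*_ν∇\*_μ` UNIFORM in the level — is a genuine lattice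
`H²`-regularity statement for `G′_□` on the (3.35) class, not yet in the tree (dag-n06-w1's piece (A2): `B9Thm31SiteBochnerY.trIP_T_cdsS_cdsS_le_of_hessian` reduces it to an
interior Hessian estimate).  THIS FILE lands everything of the READING that does not depend on that estimate, so that the conjunct closes by a 40-line packaging the hour
the estimate lands:
* §1 ★ `secondLeg_model_eq` — at the pins `h = hWalkY`, `Gsq = gsqcoS = (η²c_R) • coordOpK(G′_c)`, `Dsd = η⁻¹ • coordOpK(cdsSL)`, the composite
  `(M_h · Gsq · M_h) ∘ (Dsd ν ∘ Dsd μ)` IS `c_R • coordOpK (M_{h_c} G′_c M_{h_c} ∇\*_ν ∇\*_μ)` (`η²·η⁻¹·η⁻¹ = 1`, order zero);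
* §2 `cutMulY_apply_eq_zero_of_not_mem`, `coordOpKH_secondLeg_apply_eq_zero_off` — the leg's output lives on `□̃(c)`: print's `S_□` for this leg is again dag-n06-d's `SblkY`;
* §3 ★★ `blockBd_torus_coordOpKH_secondLeg_of_hs` — ANY block-to-block HS bound of the 𝔸-level member in dag-n06-w1's shape (constant `C₃`, rate offset `m`:
  `Σ_{Δ(t)} HS ≤ C₃·e^{−2δ₀((d_T(t,s)−m)∕(2L)−1)}·‖λ‖²₁`) gives the torus-level block bound of the coordinate model (Parseval, prequel's `blockBd_fst_coordOpKH_of_hs`);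
  ★★★ `blockBd_secondLeg_of_hs` — and then, for a member whose torus satisfies [4] Lemma 2.1's row sum `Ineq261With cr … δ₁ (1∕4)` and a faithful `bI`, the `l5` body AT THE PINS
  with indicator `1_{SblkY x bI c}` and kernel `c_R·(√C₃e^{δ₀(1+m∕(2L))}·cr·e^{3δ₁∕2}√(e^{δ₁∕4}cr))·e^{−(3δ₁∕4)d}` (the pulled-back re-blocking engine of `B9Eq346GradGpDivCoordsL2`).
* §4 ★★★ `l2SecondLegs37_memberY_of_hs` — the member-uniform packaging: from a □- and member-UNIFORM 𝔸-level bound on the (3.35) class (the target shape for the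
  instantiation of the `H²` estimate at `h = hTY`, `D = □̃(c)`), `∃ M₃ a₃ B₃ δ₃ > 0` with `L2SecondLegs37 𝔬 𝔡 R₀ H₀ (SblkY x bI) B₃ δ₃ U` at the pins, in `h36H`'s prefix.
HONEST SCOPE.  Dictionary + transfer only; the `H²` estimate is an explicit HYPOTHESIS (`hHS`, an 𝔸-level inequality at one configuration — not a named conjecture, not a
`Prop` definition); nothing of [B9] is asserted; the 𝔸-level estimate itself is NOT here (dag-n06-w1's lane) — §4 only states the □-uniform shape it must meet
and does the member-uniform packaging under it.  Count-neutral; N06 NOT discharged; K1⁷ NOT closed; one finite lattice at a time — nothing continuum ∕ OS ∕ mass gap ∕ Clay.  Cell `pub-ymgap`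
(HUMAN RULING D-0062 ∕ D-0154), Track A node N06 [B9], width seat `pub-ymgap-dag-n06-w7` (g0), 2026-08-28.  NEW file; 0 `def`; imports the built prequel only.
-/

noncomputable section

namespace Literature.MathematicalPhysics.QuantumFieldTheory.Balaban1983to89.B9Eq346SecondLegAtPinsL2

open Literature.MathematicalPhysics.QuantumFieldTheory.Balaban1983to89
open Node00 B6KLevelCensusIndexV1 B6Geom246MultiLevelBox B6MultiLevelTorusOperator B6GlobalChartV1 B9BackgroundsKLevelV1
  B9Eq39Adjoint B6Geom246MultiLevelTorus B9Eq346MixedLegAtCubesTorusL2 B9Eq346GradGpDivCoordsL2 B9Eq346GradGpDivAtPinsL2 B9Eq346MixedLegAtPinsL2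
open Literature.MathematicalPhysics.QuantumFieldTheory.Balaban1983to89.B6Ineq2142KLevelV1 (lvl β)
open Literature.MathematicalPhysics.QuantumFieldTheory.Balaban1983to89.B6Lemma21Repaired (Ineq261With)
open Literature.MathematicalPhysics.QuantumFieldTheory.Balaban1983to89.B9GeoNormsKLevelV1 (geo9K)
open Literature.MathematicalPhysics.QuantumFieldTheory.Balaban1983to89.B9Ineq349SiteComposite (cdsSL cdsSL_apply etaS_pos)
open Literature.MathematicalPhysics.QuantumFieldTheory.Balaban1983to89.B9Thm39ReadingCoords (cR39 cR39_nonneg)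
open Literature.MathematicalPhysics.QuantumFieldTheory.Balaban1983to89.B9Thm311ReadingCoords (trIP)
open Literature.MathematicalPhysics.QuantumFieldTheory.Balaban1983to89.B9CoReadingCoords (assembleK coordOpK coordOpK_apply coordOpK_comp)
open Literature.MathematicalPhysics.QuantumFieldTheory.Balaban1983to89.B9CoReadingCoordsH (coordOpKH)
open Literature.MathematicalPhysics.QuantumFieldTheory.Balaban1983to89.B9CoReadingCoordsS (XSK blkSK sIK GcoS blkV1_site)
open Literature.MathematicalPhysics.QuantumFieldTheory.Balaban1983to89.B9CoReadingCoordsTranspose (TrIdx trBasis)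
open Literature.MathematicalPhysics.QuantumFieldTheory.Balaban1983to89.B9Thm34Ext (toB6)
open Literature.MathematicalPhysics.QuantumFieldTheory.Balaban1983to89.B9SectDL2Decay (bl2 BlockBd bl2_nonneg)
open Literature.MathematicalPhysics.QuantumFieldTheory.Balaban1983to89.B9PinMembersKLevelV1 (MemberY geo9Y bg9Y reg335Y_iff)
open Literature.MathematicalPhysics.QuantumFieldTheory.Balaban1983to89.B9Thm37Sum (mulOp)
open Literature.MathematicalPhysics.QuantumFieldTheory.Balaban1983to89.B9Thm37Whole (Ops)
open Literature.MathematicalPhysics.QuantumFieldTheory.Balaban1983to89.B9RWSums346SecondDiffGp (DirOps37 L2SecondLegs37)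
open Literature.MathematicalPhysics.QuantumFieldTheory.Balaban1983to89.B9Thm314GpFlatMultiLevelTorus (consts_260_261)
open Literature.MathematicalPhysics.QuantumFieldTheory.Balaban1983to89.B9GeoLemma21KLevelV1 (one_le_Mh)
open Literature.MathematicalPhysics.QuantumFieldTheory.Balaban1983to89.B9Thm37CubeCoverCommutators (cutMulY cutMulY_apply hTY)
open Literature.MathematicalPhysics.QuantumFieldTheory.Balaban1983to89.B6Cover236MultiLevelBlocks (cubes)
open Literature.MathematicalPhysics.QuantumFieldTheory.Balaban1983to89.B9WalkLettersCoordsS (cubeDomY SblkY hWalkY gsqcoS mem_cubeDomY_of_hTY_ne_zero)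
open Literature.MathematicalPhysics.QuantumFieldTheory.Balaban1983to89.Node00.OpsYLocalInverse (GsqY)
open Literature.MathematicalPhysics.QuantumFieldTheory.Balaban1983to89.Node00.OpsYSectDCoords (coordOpKH_eq_coordOpK)
open scoped Matrix Matrix.Norms.L2Operator

variable {d ℓ : ℕ} {hd : 1 ≤ d + 1} {hL : Odd (ℓ + 1) ∧ 1 < ℓ + 1} {b₀ b₁ : ℝ} {Mstar : ℕ}
variable (x : MemberY d ℓ hd hL b₀ b₁ Mstar) {N : ℕ} {G : Subgroup (Matrix (Fin N) (Fin N) ℂ)ˣ}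

/-! ## §1 The pinned second-order composite as ONE scaled coordinate model -/

section Dictionary

/-- ★ **THE PINNED COMPOSITE `(M_h · Gsq · M_h) ∘ (Dsd ν ∘ Dsd μ)` IS `c_R • coordOpK (M_{h_c} G′_c(U) M_{h_c} ∇\*_{U,ν} ∇\*_{U,μ})`** at the pins `h = hWalkY`,
`Gsq = gsqcoS = (η²c_R) • coordOpK (G′_c)`, `Dsd = η⁻¹ • coordOpK (cdsSL)` — the units `η²·η⁻¹·η⁻¹` cancel (order zero; dag-n06-d's functor calculus).
[cite: Balaban1985BackgroundPropagators, (3.46) p.398 (third line), (3.87)–(3.88) p.409, (3.42) p.397, dictionary] -/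
theorem secondLeg_model_eq (B : B9.Backgrounds) (cfg : B.Cfg → CfgY (Matrix (Fin N) (Fin N) ℂ) x.toKIdx) (U₁ : B.Cfg) (c : ↥(cubes x.toKIdx.D.toDomains)) (ν μ : Fin (d + 1)) :
    (mulOp (hWalkY x c) * gsqcoS x (trBasis N) B cfg (parSymY x.toKIdx) c U₁ * mulOp (hWalkY x c)) ∘ₗ
        (((etaS x.toKIdx)⁻¹ • coordOpK (trBasis N) (fun _ : Fin (d + 1) => (cdsSL x.toKIdx (cfg U₁) ν).restrictScalars ℝ)) ∘ₗ
          ((etaS x.toKIdx)⁻¹ • coordOpK (trBasis N) (fun _ : Fin (d + 1) => (cdsSL x.toKIdx (cfg U₁) μ).restrictScalars ℝ)))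
      = cR39 (trBasis N) • coordOpK (trBasis N) (fun _ : Fin (d + 1) =>
          (cutMulY (hTY x.toKIdx c) ∘ₗ GsqY x.toKIdx (parSymY x.toKIdx) (cubeDomY x c) (cfg U₁) ∘ₗ cutMulY (hTY x.toKIdx c) ∘ₗ
            cdsSL x.toKIdx (cfg U₁) ν ∘ₗ cdsSL x.toKIdx (cfg U₁) μ).restrictScalars ℝ) := by
  have hη : etaS x.toKIdx ≠ 0 := (etaS_pos x.toKIdx).ne'
  rw [mulOp_hWalkY_eq_coordOpK]
  unfold gsqcoS GcoS
  simp only [Module.End.mul_eq_comp, LinearMap.smul_comp, LinearMap.comp_smul, LinearMap.comp_assoc, coordOpK_comp, restrictScalars_comp', smul_smul]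
  congr 1
  field_simp

end Dictionary

/-! ## §2 The output support: `S_□` for the second-order leg is `SblkY` -/

section Support

/-- `M_{h_c}F` vanishes off `□̃(c)`. [cite: Balaban1985BackgroundPropagators, (3.87) p.409; Balaban1984PropagatorsII, p.235, bookkeeping] -/
theorem cutMulY_apply_eq_zero_of_not_mem (c : ↥(cubes x.toKIdx.D.toDomains)) (F : SiteY x.toKIdx → Matrix (Fin N) (Fin N) ℂ) {z : SiteY x.toKIdx}
    (hz : z ∉ cubeDomY x c) : cutMulY (hTY x.toKIdx c) F z = 0 := by
  have h0 : hTY x.toKIdx c z = 0 := by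
    by_contra h; exact hz (mem_cubeDomY_of_hTY_ne_zero x c h)
  rw [cutMulY_apply, h0]
  simp

/-- the second-order model's output vanishes at every carrier point whose site block `sIK bI` is NOT in `S_□(c) = SblkY x bI c`.
[cite: Balaban1985BackgroundPropagators, (3.87) p.409; Balaban1984PropagatorsII, p.235, bookkeeping] -/
theorem coordOpKH_secondLeg_apply_eq_zero_off (bI : FBondY x.toKIdx → IBondY x.toKIdx) (c : ↥(cubes x.toKIdx.D.toDomains)) (U : CfgY (Matrix (Fin N) (Fin N) ℂ) x.toKIdx)
    (ν μ : Fin (d + 1)) (f : XSK (TrIdx N) x.toKIdx → ℝ) (p : XSK (TrIdx N) x.toKIdx) (hp : sIK x.toKIdx bI p.1 ∉ SblkY x bI c) :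
    coordOpKH (trBasis N) (fun _ : Fin (d + 1) =>
      (cutMulY (hTY x.toKIdx c) ∘ₗ GsqY x.toKIdx (parSymY x.toKIdx) (cubeDomY x c) U ∘ₗ cutMulY (hTY x.toKIdx c) ∘ₗ
        cdsSL x.toKIdx U ν ∘ₗ cdsSL x.toKIdx U μ).restrictScalars ℝ) f p = 0 := by
  have hz : p.1 ∉ cubeDomY x c := fun h => hp (Finset.mem_image_of_mem _ h)
  rw [coordOpKH_eq_coordOpK, coordOpK_apply, LinearMap.restrictScalars_apply]
  simp only [LinearMap.comp_apply]
  rw [cutMulY_apply_eq_zero_of_not_mem x c _ hz, map_zero, Finsupp.zero_apply]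

end Support

/-! ## §3 From an 𝔸-level block-to-block HS bound to the leg at the pins -/

section Transfer

open Classical in
/-- ★★ **ANY BLOCK-TO-BLOCK HS BOUND OF `M_{h_c}G′_cM_{h_c}∇\*_ν∇\*_μ` IN dag-n06-w1's SHAPE GIVES THE TORUS-LEVEL BLOCK BOUND OF THE COORDINATE MODEL**: if for every
source block `s`, output block `t` and `λ` carried by `s`, `Σ_{z∈Δ(t)} HS((M_{h_c}G′_c(U)M_{h_c}∇\*_ν∇\*_μλ)(z)) ≤ C₃·e^{−2δ₀((d_T(t,s)−m)∕(2L)−1)}·‖λ‖²₁` (`δ₀ = 1∕(4(d+2))`,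
any offset `m`), then `coordOpKH (trBasis N) (fun _ => M_{h_c}G′_cM_{h_c}∇\*_ν∇\*_μ)` has the block bound `√C₃·e^{δ₀(1+m∕(2L))}·e^{−δ₁d_T}`, `δ₁ = δ₀∕(2L)`, w.r.t. the site
blocks along `Prod.fst`. [cite: Balaban1985BackgroundPropagators, (3.46) p.398, Cor 3.6 p.408; Balaban1984PropagatorsII, (2.46) p.231, (2.54) p.233] -/
theorem blockBd_torus_coordOpKH_secondLeg_of_hs (U : CfgY (Matrix (Fin N) (Fin N) ℂ) x.toKIdx) (c : ↥(cubes x.toKIdx.D.toDomains)) (ν μ : Fin (d + 1))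
    {C3 m : ℝ} (hC3 : 0 ≤ C3)
    (hHS : ∀ (s t : BlkY x.toKIdx) {Λ : SiteY x.toKIdx → Matrix (Fin N) (Fin N) ℂ}, (∀ z : SiteY x.toKIdx, blkOf x.toKIdx.D.toDomains z ≠ s → Λ z = 0) →
      ∑ z ∈ Finset.univ.filter (fun z : SiteY x.toKIdx => blkOf x.toKIdx.D.toDomains z = t), ∑ a, ∑ b,
          ‖cutMulY (hTY x.toKIdx c) (GsqY x.toKIdx (parSymY x.toKIdx) (cubeDomY x c) U
            (cutMulY (hTY x.toKIdx c) (cdsS x.toKIdx U ν (cdsS x.toKIdx U μ Λ)))) z a b‖ ^ 2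
        ≤ C3 / Real.exp ((1 / (4 * ((d : ℝ) + 2))) * (((((bondT x.toKIdx.D).dist t s : ℝ)) - m) / (2 * ((ℓ + 1 : ℕ) : ℝ)) - 1)) ^ 2
          * trIP (fun _ => (1 : ℝ)) Λ Λ) :
    BlockBd (g := geomT x.toKIdx.D) (fun p : XSK (TrIdx N) x.toKIdx => blkOf x.toKIdx.D.toDomains p.1) (fun p : XSK (TrIdx N) x.toKIdx => blkOf x.toKIdx.D.toDomains p.1)
      (coordOpKH (trBasis N) (fun _ : Fin (d + 1) =>
        (cutMulY (hTY x.toKIdx c) ∘ₗ GsqY x.toKIdx (parSymY x.toKIdx) (cubeDomY x c) U ∘ₗ cutMulY (hTY x.toKIdx c) ∘ₗ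
          cdsSL x.toKIdx U ν ∘ₗ cdsSL x.toKIdx U μ).restrictScalars ℝ))
      (fun t s => Real.sqrt C3 * Real.exp ((1 / (4 * ((d : ℝ) + 2))) * (1 + m / (2 * ((ℓ + 1 : ℕ) : ℝ))))
        * Real.exp (-((1 / (4 * ((d : ℝ) + 2))) / (2 * ((ℓ + 1 : ℕ) : ℝ)) * (geomT x.toKIdx.D).dist t s))) := by
  set δ₀ : ℝ := 1 / (4 * ((d : ℝ) + 2)) with hδ₀
  set L2 : ℝ := 2 * ((ℓ + 1 : ℕ) : ℝ) with hL2
  have hL2pos : 0 < L2 := by rw [hL2]; positivity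
  have hK : BlockBd (g := geomT x.toKIdx.D) (fun p : XSK (TrIdx N) x.toKIdx => blkOf x.toKIdx.D.toDomains p.1) (fun p : XSK (TrIdx N) x.toKIdx => blkOf x.toKIdx.D.toDomains p.1)
      (coordOpKH (trBasis N) (fun _ : Fin (d + 1) =>
        (cutMulY (hTY x.toKIdx c) ∘ₗ GsqY x.toKIdx (parSymY x.toKIdx) (cubeDomY x c) U ∘ₗ cutMulY (hTY x.toKIdx c) ∘ₗ
          cdsSL x.toKIdx U ν ∘ₗ cdsSL x.toKIdx U μ).restrictScalars ℝ))
      (fun t s => Real.sqrt C3 * (Real.exp (δ₀ * (((((bondT x.toKIdx.D).dist t s : ℝ)) - m) / L2 - 1)))⁻¹) := by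
    refine blockBd_fst_coordOpKH_of_hs (fun t s => by positivity) fun Λ t s hΛ => ?_
    have h := hHS s t hΛ
    have hK2 : (Real.sqrt C3 * (Real.exp (δ₀ * (((((bondT x.toKIdx.D).dist t s : ℝ)) - m) / L2 - 1)))⁻¹) ^ 2
        = C3 / Real.exp (δ₀ * (((((bondT x.toKIdx.D).dist t s : ℝ)) - m) / L2 - 1)) ^ 2 := by
      rw [mul_pow, Real.sq_sqrt hC3, inv_pow]
      exact (div_eq_mul_inv _ _).symm
    rw [hK2, ← B9Ineq369CurvatureSmallAtLettersY.trIP_one_self_eq, Finset.sum_ite, Finset.sum_const_zero, add_zero]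
    convert h using 3
    all_goals rfl
  refine hK.mono fun t s => le_of_eq ?_
  have hdist : (geomT x.toKIdx.D).dist t s = (((bondT x.toKIdx.D).dist t s : ℝ)) := rfl
  rw [hdist, ← Real.exp_neg, mul_assoc (Real.sqrt C3), ← Real.exp_add]
  congr 2
  rw [hL2]
  field_simp
  ring

/-- ★★★ **THE SECOND-ORDER `L²` LEG AT THE CERTIFICATE's PINS, FROM THE 𝔸-LEVEL ESTIMATE** (dag-n06-k's `L2SecondLegs37.l5` body, letter-generic, one member, one
configuration): given the HS bound `hHS` (constant `C₃ ≥ 0`, offset `m`), [4] Lemma 2.1's row sum `Ineq261With cr (geomT x.D) δ₁ (1∕4)` at the member, a level-∕1-faithful `bI`,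
and ALL walk-letter records `𝔬 𝔡` with `𝔬.blk = blkSK (sIK bI)`, `𝔬.h ic = hWalkY x c`, `𝔬.Gsq U ic = gsqcoS … (parSymY …) c U`, `𝔡.Dsd U ν ∕ μ = η⁻¹ • coordOpK (cdsSL U ν ∕ μ)`:
`BlockBd (toB6 (geo9Y x) R₀ H₀) 𝔬.blk 𝔬.blk ((mulOp (𝔬.h ic) * 𝔬.Gsq U ic * mulOp (𝔬.h ic)) ∘ₗ (𝔡.Dsd U ν ∘ₗ 𝔡.Dsd U μ)) (1_{SblkY x bI c}(a)·c_R·(√C₃e^{δ₀(1+m∕(2L))}·cr·e^{3δ₁∕2}·√(e^{δ₁∕4}cr)·e^{−(3δ₁∕4)d(a,a′)}))`.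
[cite: Balaban1985BackgroundPropagators, Cor 3.6 p.408, Thm 3.1 (3.46) p.398, (3.87)–(3.90) pp.409–410; Balaban1984PropagatorsII, (2.46) p.231, (2.51)–(2.54) pp.232–233, Lemma 2.1 (2.61) p.234, p.235] -/
theorem blockBd_secondLeg_of_hs (U : (bg9Y (Matrix (Fin N) (Fin N) ℂ) G x).Cfg) (c : ↥(cubes x.toKIdx.D.toDomains)) (ν μ : Fin (d + 1)) {C3 m : ℝ} (hC3 : 0 ≤ C3)
    (hHS : ∀ (s t : BlkY x.toKIdx) {Λ : SiteY x.toKIdx → Matrix (Fin N) (Fin N) ℂ}, (∀ z : SiteY x.toKIdx, blkOf x.toKIdx.D.toDomains z ≠ s → Λ z = 0) →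
      ∑ z ∈ Finset.univ.filter (fun z : SiteY x.toKIdx => blkOf x.toKIdx.D.toDomains z = t), ∑ a, ∑ b,
          ‖cutMulY (hTY x.toKIdx c) (GsqY x.toKIdx (parSymY x.toKIdx) (cubeDomY x c) U
            (cutMulY (hTY x.toKIdx c) (cdsS x.toKIdx U ν (cdsS x.toKIdx U μ Λ)))) z a b‖ ^ 2
        ≤ C3 / Real.exp ((1 / (4 * ((d : ℝ) + 2))) * (((((bondT x.toKIdx.D).dist t s : ℝ)) - m) / (2 * ((ℓ + 1 : ℕ) : ℝ)) - 1)) ^ 2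
          * trIP (fun _ => (1 : ℝ)) Λ Λ)
    {cr : ℝ} (h261 : Ineq261With cr (geomT x.toKIdx.D) ((1 / (4 * ((d : ℝ) + 2))) / (2 * ((ℓ + 1 : ℕ) : ℝ))) (1 / 4))
    {bI : FBondY x.toKIdx → IBondY x.toKIdx} (hlev : ∀ f, lvl x.hN x.D x.hk (bI f) = (blkV1 x.hN x.D f).1.1)
    (hβ1 : ∀ f, (geomT x.D).dist (β x.hN x.D x.hk (bI f)) (blkV1 x.hN x.D f) ≤ 1) (R₀ : ℝ) (H₀ : Prop) [Fintype (geo9Y x).Site]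
    {Y ι : Type} (𝔬 : Ops (geo9Y x) (bg9Y (Matrix (Fin N) (Fin N) ℂ) G x) (XSK (TrIdx N) x.toKIdx) Y ι) (𝔡 : DirOps37 𝔬 (Fin (d + 1))) (ic : ι)
    (hblk : 𝔬.blk = blkSK x.toKIdx (sIK x.toKIdx bI)) (hh : 𝔬.h ic = hWalkY x c)
    (hGsq : 𝔬.Gsq U ic = gsqcoS x (trBasis N) (bg9Y (Matrix (Fin N) (Fin N) ℂ) G x) (fun U => U) (parSymY x.toKIdx) c U)
    (hDsdν : 𝔡.Dsd U ν = (etaS x.toKIdx)⁻¹ • coordOpK (trBasis N) (fun _ : Fin (d + 1) => (cdsSL x.toKIdx U ν).restrictScalars ℝ))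
    (hDsdμ : 𝔡.Dsd U μ = (etaS x.toKIdx)⁻¹ • coordOpK (trBasis N) (fun _ : Fin (d + 1) => (cdsSL x.toKIdx U μ).restrictScalars ℝ)) :
    BlockBd (g := toB6 (geo9Y x) R₀ H₀) 𝔬.blk 𝔬.blk ((mulOp (𝔬.h ic) * 𝔬.Gsq U ic * mulOp (𝔬.h ic)) ∘ₗ (𝔡.Dsd U ν ∘ₗ 𝔡.Dsd U μ))
      (fun a a' => (if a ∈ SblkY x bI c then (1 : ℝ) else 0) *
        (cR39 (trBasis N) * (Real.sqrt C3 * Real.exp ((1 / (4 * ((d : ℝ) + 2))) * (1 + m / (2 * ((ℓ + 1 : ℕ) : ℝ)))) * cr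
          * Real.exp (3 / 2 * ((1 / (4 * ((d : ℝ) + 2))) / (2 * ((ℓ + 1 : ℕ) : ℝ))))
          * Real.sqrt (Real.exp (1 / 4 * ((1 / (4 * ((d : ℝ) + 2))) / (2 * ((ℓ + 1 : ℕ) : ℝ)))) * cr)
          * Real.exp (-(3 / 4 * ((1 / (4 * ((d : ℝ) + 2))) / (2 * ((ℓ + 1 : ℕ) : ℝ))) * (geo9Y x).dist a a'))))) := by
  have hδ₁ : (0 : ℝ) ≤ (1 / (4 * ((d : ℝ) + 2))) / (2 * ((ℓ + 1 : ℕ) : ℝ)) := by positivity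
  have hC : 0 ≤ Real.sqrt C3 * Real.exp ((1 / (4 * ((d : ℝ) + 2))) * (1 + m / (2 * ((ℓ + 1 : ℕ) : ℝ)))) := by positivity
  -- the torus bound of the model, re-blocked on `blkSK (sIK bI) = bI ∘ π`, `π p = ⟨chart⁻¹ p.1, e₀⟩`, scaled by `c_R`
  have hT := blockBd_torus_coordOpKH_secondLeg_of_hs x U c ν μ hC3 hHS
  have hπ : (fun p : XSK (TrIdx N) x.toKIdx => blkOf x.toKIdx.D.toDomains p.1)
      = (fun p : XSK (TrIdx N) x.toKIdx => blkV1 x.hN x.D ((fun q : XSK (TrIdx N) x.toKIdx => (⟨(boxEquiv x.toKIdx.hN).symm q.1, 0⟩ : FBondY x.toKIdx)) p)) := by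
    funext p; exact (blkV1_site x.toKIdx p.1).symm
  rw [hπ] at hT
  letI : Fintype (geo9K x.toKIdx).Site := (inferInstance : Fintype (geo9Y x).Site)
  have hre := blockBd_pull_bI_of_blockBd_torus x.toKIdx (X := XSK (TrIdx N) x.toKIdx)
    (fun q : XSK (TrIdx N) x.toKIdx => (⟨(boxEquiv x.toKIdx.hN).symm q.1, 0⟩ : FBondY x.toKIdx)) hlev hβ1 hC hδ₁ hT h261 R₀ H₀
  have hsm := blockBd_smul_of_nonneg' hre (cR39_nonneg (trBasis N))
  rw [coordOpKH_eq_coordOpK] at hsm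
  have hblk' : (fun q : XSK (TrIdx N) x.toKIdx => bI (⟨(boxEquiv x.toKIdx.hN).symm q.1, 0⟩ : FBondY x.toKIdx)) = 𝔬.blk := by rw [hblk]; rfl
  rw [hblk'] at hsm
  -- the pinned operator is `c_R •` the model
  rw [hDsdν, hDsdμ, hGsq, hh, secondLeg_model_eq x (bg9Y (Matrix (Fin N) (Fin N) ℂ) G x) (fun U => U) U c ν μ]
  intro a' ω hω a
  dsimp only
  by_cases ha : a ∈ SblkY x bI c
  · rw [if_pos ha, one_mul]
    exact hsm a' ω hω a
  · rw [if_neg ha, zero_mul, zero_mul]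
    refine le_of_eq (bl2_eq_zero_of_forall (G' := toB6 (geo9Y x) R₀ H₀) 𝔬.blk a fun p hp => ?_)
    have hp' : sIK x.toKIdx bI p.1 ∉ SblkY x bI c := by
      have e : sIK x.toKIdx bI p.1 = a := by rw [← hp, hblk]; rfl
      rw [e]; exact ha
    rw [LinearMap.smul_apply, Pi.smul_apply, smul_eq_mul, ← coordOpKH_eq_coordOpK, coordOpKH_secondLeg_apply_eq_zero_off x bI c U ν μ ω p hp', mul_zero]

end Transfer

/-! ## §4 The member-uniform packaging: the schema `L2SecondLegs37` from a □-uniform 𝔸-level bound on the (3.35) class -/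

section Packaging

/-- ★★★ **THE SCHEMA `L2SecondLegs37` AT THE PINS FROM A □-UNIFORM 𝔸-LEVEL ESTIMATE** — the TARGET SHAPE for the instantiation of dag-n06-w1's `H²` estimate at the
partition of record: IF on the (3.35) class (`G ≤ U(N)`, `0 ≤ c₀Mα₀`, `c₀Mα₀(d+1) ≤ 1∕16`, `Reg335 c₀ α₀ U`) every member satisfies, for every cube `c`, directions `ν μ`,
blocks `s t` and `λ` on `Δ(s)`, `Σ_{Δ(t)} HS((M_{h_c}G′_cM_{h_c}∇\*_ν∇\*_μλ)(z)) ≤ C₃·e^{−2δ₀((d_T(t,s)−m)∕(2L)−1)}·‖λ‖²₁` with MEMBER-INDEPENDENT `C₃ ≥ 0`, `m`, THEN there are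
`M₃, a₃, B₃, δ₃ > 0` such that in the certificate's regime prefix, for every faithful `bI`, `R₀ H₀` and all pinned walk-letter records over the cubes,
`L2SecondLegs37 𝔬 𝔡 R₀ H₀ (SblkY x bI) B₃ δ₃ U`. [cite: Balaban1985BackgroundPropagators, Cor 3.6 p.408, Thm 3.1 (3.46) p.398, (3.87)–(3.90) pp.409–410, (3.35) p.396; Balaban1984PropagatorsII, (2.46) p.231, (2.51)–(2.54) pp.232–233, Lemma 2.1 (2.61) p.234, p.235] -/
theorem l2SecondLegs37_memberY_of_hs (d ℓ : ℕ) (hd : 1 ≤ d + 1) (hL : Odd (ℓ + 1) ∧ 1 < ℓ + 1) (b₀ b₁ : ℝ) (Mstar N : ℕ) [NeZero N] {c₀ : ℝ} (hc₀ : 0 < c₀)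
    {C3 m : ℝ} (hC3 : 0 ≤ C3)
    (hHSu : ∀ {G : Subgroup (Matrix (Fin N) (Fin N) ℂ)ˣ} (_ : G ≤ B7Prop2Explicit.unitaryUnits (Matrix (Fin N) (Fin N) ℂ))
      (x : MemberY d ℓ hd hL b₀ b₁ Mstar) {U : CfgY (Matrix (Fin N) (Fin N) ℂ) x.toKIdx} {α₀ : ℝ},
      0 ≤ c₀ * (geo9Y x).M * α₀ → c₀ * (geo9Y x).M * α₀ * ((d : ℝ) + 1) ≤ 1 / 16 → (bg9K (Matrix (Fin N) (Fin N) ℂ) G x.toKIdx).Reg335 c₀ α₀ U →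
      ∀ (c : ↥(cubes x.toKIdx.D.toDomains)) (ν μ : Fin (d + 1)) (s t : BlkY x.toKIdx) {Λ : SiteY x.toKIdx → Matrix (Fin N) (Fin N) ℂ},
        (∀ z : SiteY x.toKIdx, blkOf x.toKIdx.D.toDomains z ≠ s → Λ z = 0) →
        ∑ z ∈ Finset.univ.filter (fun z : SiteY x.toKIdx => blkOf x.toKIdx.D.toDomains z = t), ∑ a, ∑ b,
            ‖cutMulY (hTY x.toKIdx c) (GsqY x.toKIdx (parSymY x.toKIdx) (cubeDomY x c) U
              (cutMulY (hTY x.toKIdx c) (cdsS x.toKIdx U ν (cdsS x.toKIdx U μ Λ)))) z a b‖ ^ 2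
          ≤ C3 / Real.exp ((1 / (4 * ((d : ℝ) + 2))) * (((((bondT x.toKIdx.D).dist t s : ℝ)) - m) / (2 * ((ℓ + 1 : ℕ) : ℝ)) - 1)) ^ 2
            * trIP (fun _ => (1 : ℝ)) Λ Λ) :
    ∃ M3 a3 B3 δ3 : ℝ, 0 < M3 ∧ 0 < a3 ∧ 0 < B3 ∧ 0 < δ3 ∧
      ∀ {G : Subgroup (Matrix (Fin N) (Fin N) ℂ)ˣ} (_ : G ≤ B7Prop2Explicit.unitaryUnits (Matrix (Fin N) (Fin N) ℂ))
        (x : MemberY d ℓ hd hL b₀ b₁ Mstar), M3 ≤ (geo9Y x).M → ∀ α₀ : ℝ, 0 < α₀ → c₀ * (geo9Y x).M * α₀ ≤ a3 →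
      ∀ (U : (bg9Y (Matrix (Fin N) (Fin N) ℂ) G x).Cfg), (bg9Y (Matrix (Fin N) (Fin N) ℂ) G x).Reg335 c₀ α₀ U →
      ∀ {bI : FBondY x.toKIdx → IBondY x.toKIdx} (_ : ∀ f, lvl x.hN x.D x.hk (bI f) = (blkV1 x.hN x.D f).1.1)
        (_ : ∀ f, (geomT x.D).dist (β x.hN x.D x.hk (bI f)) (blkV1 x.hN x.D f) ≤ 1) (R₀ : ℝ) (H₀ : Prop) [Fintype (geo9Y x).Site] [DecidableEq (geo9Y x).Site]
        {Y : Type} (𝔬 : Ops (geo9Y x) (bg9Y (Matrix (Fin N) (Fin N) ℂ) G x) (XSK (TrIdx N) x.toKIdx) Y ↥(cubes x.toKIdx.D.toDomains)) (𝔡 : DirOps37 𝔬 (Fin (d + 1)))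
        (_ : 𝔬.blk = blkSK x.toKIdx (sIK x.toKIdx bI)) (_ : ∀ c, 𝔬.h c = hWalkY x c)
        (_ : ∀ c, 𝔬.Gsq U c = gsqcoS x (trBasis N) (bg9Y (Matrix (Fin N) (Fin N) ℂ) G x) (fun U => U) (parSymY x.toKIdx) c U)
        (_ : ∀ μ, 𝔡.Dsd U μ = (etaS x.toKIdx)⁻¹ • coordOpK (trBasis N) (fun _ : Fin (d + 1) => (cdsSL x.toKIdx U μ).restrictScalars ℝ)),
        L2SecondLegs37 𝔬 𝔡 R₀ H₀ (SblkY x bI) B3 δ3 U := by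
  set δ₀ : ℝ := 1 / (4 * ((d : ℝ) + 2)) with hδ₀
  set δ₁ : ℝ := δ₀ / (2 * ((ℓ + 1 : ℕ) : ℝ)) with hδ₁
  have hδ₀pos : 0 < δ₀ := by rw [hδ₀]; positivity
  have hδ₁pos : 0 < δ₁ := by rw [hδ₁]; positivity
  obtain ⟨N₁, cr, -, hcr0, hcon⟩ := consts_260_261 d ℓ hδ₁pos
  set C₁ : ℝ := Real.sqrt C3 * Real.exp (δ₀ * (1 + m / (2 * ((ℓ + 1 : ℕ) : ℝ)))) with hC₁
  set B3 : ℝ := max (cR39 (trBasis N) * (C₁ * cr * Real.exp (3 / 2 * δ₁) * Real.sqrt (Real.exp (1 / 4 * δ₁) * cr))) 1 with hB3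
  refine ⟨(N₁ : ℝ) + 1, 1 / (16 * ((d : ℝ) + 1)), B3, 3 / 4 * δ₁, by positivity, by positivity, lt_of_lt_of_le one_pos (le_max_right _ _), by positivity, ?_⟩
  intro G hG x hM α₀ hα₀ ha U hU bI hlev hβ1 R₀ H₀ _ _ Y 𝔬 𝔡 hblk hh hGsq hDsd
  haveI : Nonempty (Fin N) := ⟨⟨0, Nat.pos_of_ne_zero (NeZero.ne N)⟩⟩
  -- the certificate's prefix gives the class hypotheses
  have hM0 : 0 ≤ (geo9Y x).M := le_trans (by positivity) hM
  have hC0 : 0 ≤ c₀ * (geo9Y x).M * α₀ := by positivity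
  have hC1 : c₀ * (geo9Y x).M * α₀ * ((d : ℝ) + 1) ≤ 1 / 16 := by
    calc c₀ * (geo9Y x).M * α₀ * ((d : ℝ) + 1) ≤ 1 / (16 * ((d : ℝ) + 1)) * ((d : ℝ) + 1) := mul_le_mul_of_nonneg_right ha (by positivity)
      _ = 1 / 16 := by field_simp
  have hreg : (bg9K (Matrix (Fin N) (Fin N) ℂ) G x.toKIdx).Reg335 c₀ α₀ U := ((reg335Y_iff x c₀ α₀ U).1 hU).1
  -- Lemma 2.1's row sum at the member
  have hLcast : (((ℓ + 1 : ℕ) : ℝ)) = (ℓ : ℝ) + 1 := by push_cast; ring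
  have hMdef : (geo9Y x).M = (((ℓ + 1 : ℕ) : ℝ)) * (x.toKIdx.Mh : ℝ) := rfl
  have hN : (N₁ : ℝ) + 1 ≤ ((ℓ : ℝ) + 1) * x.toKIdx.Mh := by rw [← hLcast, ← hMdef]; exact hM
  have hR1 : 1 ≤ x.toKIdx.R := le_trans (by omega) (toKT x.toKIdx).hR
  have hRN : N₁ + 1 ≤ x.toKIdx.R * ((ℓ + 1) * x.toKIdx.Mh) := by
    have h2 : N₁ + 1 ≤ (ℓ + 1) * x.toKIdx.Mh := by exact_mod_cast hN
    calc N₁ + 1 ≤ 1 * ((ℓ + 1) * x.toKIdx.Mh) := by rw [one_mul]; exact h2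
      _ ≤ x.toKIdx.R * ((ℓ + 1) * x.toKIdx.Mh) := Nat.mul_le_mul_right _ hR1
  obtain ⟨-, h261⟩ := hcon x.toKIdx.k x.toKIdx.Mh x.toKIdx.R x.toKIdx.P' (one_le_Mh x.toKIdx) (toKT x.toKIdx).hP hRN
  have h261D : Ineq261With cr (geomT x.toKIdx.D) δ₁ (1 / 4) := h261 x.toKIdx.D
  have hle : cR39 (trBasis N) * (C₁ * cr * Real.exp (3 / 2 * δ₁) * Real.sqrt (Real.exp (1 / 4 * δ₁) * cr)) ≤ B3 := le_max_left _ _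
  refine ⟨fun c ν μ => ?_⟩
  have H := blockBd_secondLeg_of_hs x U c ν μ hC3 (fun s t Λ hΛ => hHSu hG x hC0 hC1 hreg c ν μ s t hΛ) h261D hlev hβ1 R₀ H₀ 𝔬 𝔡 c hblk (hh c) (hGsq c) (hDsd ν) (hDsd μ)
  intro a' ω hω a
  refine (H a' ω hω a).trans (mul_le_mul_of_nonneg_right ?_ (bl2_nonneg (g := toB6 (geo9Y x) R₀ H₀) 𝔬.blk a' ω))
  -- the kernel comparison: the indicator agrees (up to the `Decidable` instance), the constant is below `B₃`, the rate is `3δ₁∕4`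
  dsimp only
  have hexp0 : 0 ≤ Real.exp (-(3 / 4 * δ₁ * (geo9Y x).dist a a')) := (Real.exp_pos _).le
  have hmain : cR39 (trBasis N) * (C₁ * cr * Real.exp (3 / 2 * δ₁) * Real.sqrt (Real.exp (1 / 4 * δ₁) * cr) * Real.exp (-(3 / 4 * δ₁ * (geo9Y x).dist a a')))
      ≤ B3 * Real.exp (-(3 / 4 * δ₁ * (geo9Y x).dist a a')) := by
    calc cR39 (trBasis N) * (C₁ * cr * Real.exp (3 / 2 * δ₁) * Real.sqrt (Real.exp (1 / 4 * δ₁) * cr) * Real.exp (-(3 / 4 * δ₁ * (geo9Y x).dist a a')))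
        = (cR39 (trBasis N) * (C₁ * cr * Real.exp (3 / 2 * δ₁) * Real.sqrt (Real.exp (1 / 4 * δ₁) * cr))) * Real.exp (-(3 / 4 * δ₁ * (geo9Y x).dist a a')) := by ring
      _ ≤ B3 * Real.exp (-(3 / 4 * δ₁ * (geo9Y x).dist a a')) := mul_le_mul_of_nonneg_right hle hexp0
  -- the two indicators are the same proposition decided by two instances (the global one and the certificate's)
  split_ifs
  · rw [one_mul, one_mul]; exact hmain
  · exact absurd ‹a ∈ SblkY x bI c› ‹¬ (a ∈ SblkY x bI c)›
  · exact absurd ‹a ∈ SblkY x bI c› ‹¬ (a ∈ SblkY x bI c)›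
  · rw [zero_mul, zero_mul]

end Packaging

/-! ## §5 (v1.1, append-only) The packaging under a per-member WINDOW hypothesis — the located-binder route -/

section PackagingWindow

/-- ★★★ **THE SCHEMA `L2SecondLegs37` AT THE PINS FROM A □-UNIFORM 𝔸-LEVEL ESTIMATE HOLDING UNDER A PER-MEMBER SIDE CONDITION `W x U c`** (v1.1; the located-binder
route for the plaquette window near `□̃(c)`, which the typed class (3.35) does not supply at uncovered big-block faces — dag-n06-j `B9Eq335CoverageAtLettersY`): IF the
𝔸-level block-to-block bound of §4 holds for every member, configuration of the class and cube `c` SATISFYING `W x U c` (any family of propositions — e.g. the pointwise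
plaquette window within two lattice steps of `cubeDomY x c` in the scaled form `‖U(∂p) − 1‖ ≤ w₀·L^{−2(j(c)+1)}`), THEN `∃ M₃ a₃ B₃ δ₃ > 0` such that, in the certificate's
prefix and for every member and configuration with `∀ c, W x U c`, `L2SecondLegs37 𝔬 𝔡 R₀ H₀ (SblkY x bI) B₃ δ₃ U` at the pins.  (`W := fun _ _ _ => True` is §4.)
[cite: Balaban1985BackgroundPropagators, Cor 3.6 p.408, Thm 3.1 (3.46) p.398, (3.87)–(3.90) pp.409–410, (3.35) p.396, (3.69) p.404; Balaban1984PropagatorsII, (2.46) p.231, (2.51)–(2.54) pp.232–233, Lemma 2.1 (2.61) p.234, p.235] -/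
theorem l2SecondLegs37_memberY_of_hs_window (d ℓ : ℕ) (hd : 1 ≤ d + 1) (hL : Odd (ℓ + 1) ∧ 1 < ℓ + 1) (b₀ b₁ : ℝ) (Mstar N : ℕ) [NeZero N] {c₀ : ℝ} (hc₀ : 0 < c₀)
    {C3 m : ℝ} (hC3 : 0 ≤ C3)
    (W : ∀ x : MemberY d ℓ hd hL b₀ b₁ Mstar, CfgY (Matrix (Fin N) (Fin N) ℂ) x.toKIdx → ↥(cubes x.toKIdx.D.toDomains) → Prop)
    (hHSuW : ∀ {G : Subgroup (Matrix (Fin N) (Fin N) ℂ)ˣ} (_ : G ≤ B7Prop2Explicit.unitaryUnits (Matrix (Fin N) (Fin N) ℂ))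
      (x : MemberY d ℓ hd hL b₀ b₁ Mstar) {U : CfgY (Matrix (Fin N) (Fin N) ℂ) x.toKIdx} {α₀ : ℝ},
      0 ≤ c₀ * (geo9Y x).M * α₀ → c₀ * (geo9Y x).M * α₀ * ((d : ℝ) + 1) ≤ 1 / 16 → (bg9K (Matrix (Fin N) (Fin N) ℂ) G x.toKIdx).Reg335 c₀ α₀ U →
      ∀ (c : ↥(cubes x.toKIdx.D.toDomains)), W x U c → ∀ (ν μ : Fin (d + 1)) (s t : BlkY x.toKIdx) {Λ : SiteY x.toKIdx → Matrix (Fin N) (Fin N) ℂ},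
        (∀ z : SiteY x.toKIdx, blkOf x.toKIdx.D.toDomains z ≠ s → Λ z = 0) →
        ∑ z ∈ Finset.univ.filter (fun z : SiteY x.toKIdx => blkOf x.toKIdx.D.toDomains z = t), ∑ a, ∑ b,
            ‖cutMulY (hTY x.toKIdx c) (GsqY x.toKIdx (parSymY x.toKIdx) (cubeDomY x c) U
              (cutMulY (hTY x.toKIdx c) (cdsS x.toKIdx U ν (cdsS x.toKIdx U μ Λ)))) z a b‖ ^ 2
          ≤ C3 / Real.exp ((1 / (4 * ((d : ℝ) + 2))) * (((((bondT x.toKIdx.D).dist t s : ℝ)) - m) / (2 * ((ℓ + 1 : ℕ) : ℝ)) - 1)) ^ 2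
            * trIP (fun _ => (1 : ℝ)) Λ Λ) :
    ∃ M3 a3 B3 δ3 : ℝ, 0 < M3 ∧ 0 < a3 ∧ 0 < B3 ∧ 0 < δ3 ∧
      ∀ {G : Subgroup (Matrix (Fin N) (Fin N) ℂ)ˣ} (_ : G ≤ B7Prop2Explicit.unitaryUnits (Matrix (Fin N) (Fin N) ℂ))
        (x : MemberY d ℓ hd hL b₀ b₁ Mstar), M3 ≤ (geo9Y x).M → ∀ α₀ : ℝ, 0 < α₀ → c₀ * (geo9Y x).M * α₀ ≤ a3 →
      ∀ (U : (bg9Y (Matrix (Fin N) (Fin N) ℂ) G x).Cfg), (bg9Y (Matrix (Fin N) (Fin N) ℂ) G x).Reg335 c₀ α₀ U → (∀ c, W x U c) →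
      ∀ {bI : FBondY x.toKIdx → IBondY x.toKIdx} (_ : ∀ f, lvl x.hN x.D x.hk (bI f) = (blkV1 x.hN x.D f).1.1)
        (_ : ∀ f, (geomT x.D).dist (β x.hN x.D x.hk (bI f)) (blkV1 x.hN x.D f) ≤ 1) (R₀ : ℝ) (H₀ : Prop) [Fintype (geo9Y x).Site] [DecidableEq (geo9Y x).Site]
        {Y : Type} (𝔬 : Ops (geo9Y x) (bg9Y (Matrix (Fin N) (Fin N) ℂ) G x) (XSK (TrIdx N) x.toKIdx) Y ↥(cubes x.toKIdx.D.toDomains)) (𝔡 : DirOps37 𝔬 (Fin (d + 1)))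
        (_ : 𝔬.blk = blkSK x.toKIdx (sIK x.toKIdx bI)) (_ : ∀ c, 𝔬.h c = hWalkY x c)
        (_ : ∀ c, 𝔬.Gsq U c = gsqcoS x (trBasis N) (bg9Y (Matrix (Fin N) (Fin N) ℂ) G x) (fun U => U) (parSymY x.toKIdx) c U)
        (_ : ∀ μ, 𝔡.Dsd U μ = (etaS x.toKIdx)⁻¹ • coordOpK (trBasis N) (fun _ : Fin (d + 1) => (cdsSL x.toKIdx U μ).restrictScalars ℝ)),
        L2SecondLegs37 𝔬 𝔡 R₀ H₀ (SblkY x bI) B3 δ3 U := by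
  set δ₀ : ℝ := 1 / (4 * ((d : ℝ) + 2)) with hδ₀
  set δ₁ : ℝ := δ₀ / (2 * ((ℓ + 1 : ℕ) : ℝ)) with hδ₁
  have hδ₀pos : 0 < δ₀ := by rw [hδ₀]; positivity
  have hδ₁pos : 0 < δ₁ := by rw [hδ₁]; positivity
  obtain ⟨N₁, cr, -, hcr0, hcon⟩ := consts_260_261 d ℓ hδ₁pos
  set C₁ : ℝ := Real.sqrt C3 * Real.exp (δ₀ * (1 + m / (2 * ((ℓ + 1 : ℕ) : ℝ)))) with hC₁
  set B3 : ℝ := max (cR39 (trBasis N) * (C₁ * cr * Real.exp (3 / 2 * δ₁) * Real.sqrt (Real.exp (1 / 4 * δ₁) * cr))) 1 with hB3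
  refine ⟨(N₁ : ℝ) + 1, 1 / (16 * ((d : ℝ) + 1)), B3, 3 / 4 * δ₁, by positivity, by positivity, lt_of_lt_of_le one_pos (le_max_right _ _), by positivity, ?_⟩
  intro G hG x hM α₀ hα₀ ha U hU hW bI hlev hβ1 R₀ H₀ _ _ Y 𝔬 𝔡 hblk hh hGsq hDsd
  haveI : Nonempty (Fin N) := ⟨⟨0, Nat.pos_of_ne_zero (NeZero.ne N)⟩⟩
  have hM0 : 0 ≤ (geo9Y x).M := le_trans (by positivity) hM
  have hC0 : 0 ≤ c₀ * (geo9Y x).M * α₀ := by positivity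
  have hC1 : c₀ * (geo9Y x).M * α₀ * ((d : ℝ) + 1) ≤ 1 / 16 := by
    calc c₀ * (geo9Y x).M * α₀ * ((d : ℝ) + 1) ≤ 1 / (16 * ((d : ℝ) + 1)) * ((d : ℝ) + 1) := mul_le_mul_of_nonneg_right ha (by positivity)
      _ = 1 / 16 := by field_simp
  have hreg : (bg9K (Matrix (Fin N) (Fin N) ℂ) G x.toKIdx).Reg335 c₀ α₀ U := ((reg335Y_iff x c₀ α₀ U).1 hU).1
  have hLcast : (((ℓ + 1 : ℕ) : ℝ)) = (ℓ : ℝ) + 1 := by push_cast; ring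
  have hMdef : (geo9Y x).M = (((ℓ + 1 : ℕ) : ℝ)) * (x.toKIdx.Mh : ℝ) := rfl
  have hN : (N₁ : ℝ) + 1 ≤ ((ℓ : ℝ) + 1) * x.toKIdx.Mh := by rw [← hLcast, ← hMdef]; exact hM
  have hR1 : 1 ≤ x.toKIdx.R := le_trans (by omega) (toKT x.toKIdx).hR
  have hRN : N₁ + 1 ≤ x.toKIdx.R * ((ℓ + 1) * x.toKIdx.Mh) := by
    have h2 : N₁ + 1 ≤ (ℓ + 1) * x.toKIdx.Mh := by exact_mod_cast hN
    calc N₁ + 1 ≤ 1 * ((ℓ + 1) * x.toKIdx.Mh) := by rw [one_mul]; exact h2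
      _ ≤ x.toKIdx.R * ((ℓ + 1) * x.toKIdx.Mh) := Nat.mul_le_mul_right _ hR1
  obtain ⟨-, h261⟩ := hcon x.toKIdx.k x.toKIdx.Mh x.toKIdx.R x.toKIdx.P' (one_le_Mh x.toKIdx) (toKT x.toKIdx).hP hRN
  have h261D : Ineq261With cr (geomT x.toKIdx.D) δ₁ (1 / 4) := h261 x.toKIdx.D
  have hle : cR39 (trBasis N) * (C₁ * cr * Real.exp (3 / 2 * δ₁) * Real.sqrt (Real.exp (1 / 4 * δ₁) * cr)) ≤ B3 := le_max_left _ _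
  refine ⟨fun c ν μ => ?_⟩
  have H := blockBd_secondLeg_of_hs x U c ν μ hC3 (fun s t Λ hΛ => hHSuW hG x hC0 hC1 hreg c (hW c) ν μ s t hΛ) h261D hlev hβ1 R₀ H₀ 𝔬 𝔡 c hblk (hh c) (hGsq c)
    (hDsd ν) (hDsd μ)
  intro a' ω hω a
  refine (H a' ω hω a).trans (mul_le_mul_of_nonneg_right ?_ (bl2_nonneg (g := toB6 (geo9Y x) R₀ H₀) 𝔬.blk a' ω))
  dsimp only
  have hexp0 : 0 ≤ Real.exp (-(3 / 4 * δ₁ * (geo9Y x).dist a a')) := (Real.exp_pos _).le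
  have hmain : cR39 (trBasis N) * (C₁ * cr * Real.exp (3 / 2 * δ₁) * Real.sqrt (Real.exp (1 / 4 * δ₁) * cr) * Real.exp (-(3 / 4 * δ₁ * (geo9Y x).dist a a')))
      ≤ B3 * Real.exp (-(3 / 4 * δ₁ * (geo9Y x).dist a a')) := by
    calc cR39 (trBasis N) * (C₁ * cr * Real.exp (3 / 2 * δ₁) * Real.sqrt (Real.exp (1 / 4 * δ₁) * cr) * Real.exp (-(3 / 4 * δ₁ * (geo9Y x).dist a a')))
        = (cR39 (trBasis N) * (C₁ * cr * Real.exp (3 / 2 * δ₁) * Real.sqrt (Real.exp (1 / 4 * δ₁) * cr))) * Real.exp (-(3 / 4 * δ₁ * (geo9Y x).dist a a')) := by ring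
      _ ≤ B3 * Real.exp (-(3 / 4 * δ₁ * (geo9Y x).dist a a')) := mul_le_mul_of_nonneg_right hle hexp0
  split_ifs
  · rw [one_mul, one_mul]; exact hmain
  · exact absurd ‹a ∈ SblkY x bI c› ‹¬ (a ∈ SblkY x bI c)›
  · exact absurd ‹a ∈ SblkY x bI c› ‹¬ (a ∈ SblkY x bI c)›
  · rw [zero_mul, zero_mul]

end PackagingWindow

end Literature.MathematicalPhysics.QuantumFieldTheory.Balaban1983to89.B9Eq346SecondLegAtPinsL2

end
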